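import Mathlib
import Literature.MathematicalPhysics.QuantumFieldTheory.Balaban1983to89.B6BondElimination
import Literature.MathematicalPhysics.QuantumFieldTheory.Balaban1983to89.B6Sect5Torus

/-!
# `Balaban1983to89.B6BondEliminationTorus` — the explicit bond elimination B = CB′ of B6 p. 250 ON THE TORUS T^{(k)},
by transport: a frame-generic sub-family reduction, the P-PERIODIC FRAME on ℤ^d with its engine PROVED, and the
sentence of p. 250 with [3] discharged on the carrier it is printed for

B6 = T. Bałaban, *Propagators and renormalization transformations for lattice gauge theories. II*, Commun. Math.
Phys. **96**, 223–250 (1984) [Balaban1984PropagatorsII]; [3] = B4 = T. Bałaban, *Regularity and decay of lattice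
Green's functions*, Commun. Math. Phys. **89** (1983) 571–597 [Balaban1983RegularityDecay], Sect. 5 Theorem p. 594.
Quotations read from the ×2 page renders `run/shared/lean/pub/pub-balaban/b2b-balaban-ref1/pages/
1984-cmp96-propagators-rt-II/…-p027-x2.png` (p. 249) and `…-p028-x2.png` (p. 250) (journal page = PDF page + 222),
not from an OCR layer.

CITATION HEADER (lean-in-tree rule 2026-08-18).  Cell `pub-balaban`, unit `b2b-balaban-pv09-g4` (surge node prover
#09, gen 4, node 3; journal claim G-pv09g4-2-KERNEL = B6-S5-BOND-ELIMINATION-TORUS).  Siblings imported, none edited: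
`…B6BondElimination` (unit b06-g3: the padding engine `pad`, and the EXPLICIT elimination matrix C = `elimB` of p. 250
with the reduction `bondReduction` and its printed-shape properties `bondReduction_printed`, all typed over finite
Ω ⊂ ℤ^d), `…B6Sect5Torus` (this unit, node 2: the torus frame and the torus engine) and through it
`…B6FrameReduction` (unit b06-g4: frames, engines, `engine_of_profileBound`) and `…B4Sect5Torus` (this unit, node 1:
`tdist`, `torusSum_le`, the Sect. 5 Theorem of [3] on tori).

## What is printed (verbatim)

* B6 p. 249, before (2.153) [display printed with the label "(1.152)", sic — cell DIVERGENCE D-b06.9]: the integral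
  (2.152) is taken *"on the whole lattice T^{(k)}, or on a subset Λ ⊂ T^{(k)}."*; then *"Using (2.118) and (2.128)
  we get ⟨B, Δ_kB⟩ ≥ (γ₀/12d²)L^{−d−1}‖B‖², or Δ_k ≥ (γ₀/12d²)L^{−d−1} (2.153) on the subspace of B satisfying:
  QB = 0, B(Γ_{y,x}) = 0 for x ∈ B(y)."*
* B6 pp. 249–250: *"We remove the variables B_b for b ⊂ Γ_{y,x} using the δ-functions δ_{Ax}(B). Next we remove the
  variables B_{b₀}, where b₀ is a bond belonging to B(c) for some c ∈ Λ′, and contained in c, using the δ-functions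
  δ((QB)(c)). If we denote the remaining variables by B′, then we can write B = CB′, where C is a linear operator, and
  we have … (2.155) hence C^{(k)}_Λ = C(C*Δ_kC)⁻¹C*. (2.156) … C is a short-ranged operator, so C*Δ_kC has the same
  exponential decay as Δ_k. Now we may apply the theory developed in Sect. 5 of [3] on unit lattice operators. It
  gives us an exponential decay, and all the other properties, for the operator (C*Δ_kC)⁻¹, hence for C^{(k)}_Λ
  also."*

`…B6BondElimination.bond250_uniform` proves the last sentence for finite Ω ⊂ Z^d with the distance of Z^d and the
theorem of [3] as a hypothesis (`B4.Sect5ThmUniform d d`, since proved: `B4Sect5Proof.sect5ThmUniform_holds`).  At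
(S5) the carrier is the TORUS T^{(k)} (cell census G-pv09g2-1 (vi), G-pv09g4-2): distances between bonds are periodic.

## The transport (why nothing of `…B6BondElimination` §§3–5 is re-indexed)

Sites of the torus T_P = ∏_μ ℤ/P_μℤ are handled through INTEGER REPRESENTATIVES z ∈ ℤ^d, exactly the index vocabulary
of `…B6BondElimination`; what changes is only the DISTANCE: the P-periodic sup-distance
ρ_P(z, z′) = max_μ dist(z_μ − z′_μ, P_μℤ) = `B4Sect5Torus.tdist P (res z) (res z′)` (§2), a pseudo-metric on ℤ^d with
ρ_P ≤ |z − z′| (`pdist_le_dist`).  A finite Ω₀ ⊂ ℤ^d that is ρ_P-SEPARATED (no two of its points congruent mod P — e.g.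
the box ∏_μ [0, P_μ), which represents the WHOLE torus, `box_separated`) IS a region of the torus, and an operator on
the bond variables Ω₀ × Fin d with |Δ(b,b′)| ≤ c₀e^{−δ₀ρ_P(b₋,b′₋)} IS a torus operator with the printed decay.  The
elimination matrix C = `elimB L Ω₀ K Y` of unit b06-g3 (blocks, pivots b₀(c), trees Γ_{y,x} in the coordinates of
Ω₀ — for the box with L ∣ P_μ these are the blocks of the torus, none wrapping) is then used VERBATIM: its range
bound |b₋ − b′₋| ≤ L − 1 in the distance of ℤ^d implies the same bound in ρ_P, and its other printed-shape properties
(ℓ¹ bounds, ‖CB′‖ ≥ ‖B′‖, B = CB′ constrained) do not see the metric.  The theorem of [3] enters through the ENGINE OF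
THE PERIODIC CLASS (§2, `engine_per`), proved from the torus lattice sums of `…B4Sect5Torus` (profile N·K_d(a),
`B6FrameReduction.engine_of_profileBound`) — one (c₁, δ₁) for all period vectors P and all separated regions.

## Kernel-checked here (no `sorry`; axioms ⊆ {propext, Classical.choice, Quot.sound})

§1 `FrameSubReduction F N` (Ω ⊂ F.S, kept variables an ARBITRARY sub-family Fk ⊆ Ω × Fin N, Δ, C), `.cov` =
C(C*ΔC)⁻¹C* (2.156), `.Printed` (printed-shape inputs w.r.t. F.ρ), `hyp56_pad_frame` (padding preserves (5.6)_ρ,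
`B6BondElimination.pad` in the pseudo-metric space `F.pms`), `frameSubReductions_uniform` — an engine on a class 𝒞
gives ONE (c, δ) for every sub-family reduction over every (F, Ω) ∈ 𝒞: `B6BondElimination.subReductions_uniform`
with ℤ^d replaced by a frame and `B4.Sect5ThmUniform` by `B6FrameReduction.Engine`.
§2 `res`, `pdist` (ρ_P), `pdist_le_dist`, `zdPer d P hP : Frame`, `Separated`, `perClass`, `perSum_le` (the profile
N·K_d(a) on separated regions), `engine_per : Engine N (perClass d)` — PROVED.  `box`, `box_separated` (the box
∏[0,P_μ) is separated: it is the whole torus).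
§3 `ofPer` (a `B6BondElimination.SubReduction` read over the periodic frame), `PrintedPer` (its printed-shape inputs
in ρ_P), `subReductions_per`, `bondReduction_printedPer` (admissible (K, Y), Δ symmetric with PERIODIC decay and
(2.153) on {QB = 0, B(Γ_{y,x}) = 0} ⇒ the printed-shape inputs in ρ_P with (r, m) = (L − 1, L^d + 1)), and
`bond250_torus` — the sentence of p. 250 ON THE TORUS with [3] DISCHARGED: ∃ (c, δ) after (d, L, γ, c₀, δ₀) and
BEFORE the period vector, the region, the constraint data and the operator, such that
|C(C*Δ_kC)⁻¹C*(b, b′)| ≤ c·e^{−δρ_P(b₋, b′₋)}.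

## Typing remarks / scope

(i) The hypothesis (2.153) stays a hypothesis exactly as in `…B6BondElimination` (`LowerOnConstrained`; B6 derives it
from (2.118) and Lemma 2.4).  (ii) L ∣ P_μ (blocks of the torus do not wrap) is not needed by the theorem: it is what
makes `Admissible L Ω₀ K` with Ω₀ = box the honest reading of "c ∈ Λ′" — a modelling remark, not a hypothesis of the
kernel statement.  (iii) *"all the other properties"* ((5.8), (5.10)) are not transported (as in the siblings).
Value = kernel certificate closing the located gap G-pv09g4-2 (the last ℤ^d-only asymmetry at (S5)); NOT summit
progress.
-/

open Finset Matrix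

namespace Literature.MathematicalPhysics.QuantumFieldTheory.Balaban1983to89.B6BondEliminationTorus

open B6FrameReduction (Frame Engine)
open B4Sect5Torus (TSite tdist)
open B6BondElimination (pad pad_inv pad_coe pad_isSymm pad_lower pad_decay isUnit_det_of_lower)

noncomputable section

/-! ## §1  Sub-family reductions over a frame: the padding engine of `…B6BondElimination` §§1–2, carrier-free -/

section FrameSub

variable {N : ℕ}

/-- ONE INSTANCE of a constrained unit-lattice Gaussian over a frame F with the kept variables B′ an ARBITRARY
sub-family of Ω × Fin N — `B6BondElimination.SubReduction` with ℤ^d replaced by F (p. 249: *"If we denote the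
remaining variables by B′, then we can write B = CB′"*). [cite: Balaban1984PropagatorsII, (2.154)–(2.156) pp.249–250] -/
structure FrameSubReduction (F : Frame) (N : ℕ) where
  /-- the sites carrying the variables B -/
  Ω : Finset F.S
  /-- the kept variables B′ ⊆ Ω × Fin N -/
  Fk : Finset (F.Idx Ω N)
  /-- the operator of the quadratic form (Δ_k) -/
  Δ : Matrix (F.Idx Ω N) (F.Idx Ω N) ℝ
  /-- B = CB′ -/
  C : Matrix (F.Idx Ω N) Fk ℝ

variable {F : Frame}

/-- The covariance (2.156) verbatim: *"C^{(k)}_Λ = C(C*Δ_kC)⁻¹C*"*. [cite: Balaban1984PropagatorsII, (2.156) p.250] -/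
def FrameSubReduction.cov (T : FrameSubReduction F N) : Matrix (F.Idx T.Ω N) (F.Idx T.Ω N) ℝ :=
  T.C * (T.Cᵀ * T.Δ * T.C)⁻¹ * T.Cᵀ

/-- The printed-shape inputs w.r.t. the frame's ρ (as `B6BondElimination.SubReduction.Printed` with |·−·| ↦ ρ):
Δ symmetric with |Δ(b,b′)| ≤ c₀e^{−δ₀ρ(b₋,b′₋)}; γ‖CB′‖² ≤ ⟨CB′, ΔCB′⟩ ((2.153) ⇒ (2.157)); ‖CB′‖ ≥ ‖B′‖; C of range
≤ r in ρ with ℓ¹ row/column sums ≤ m. [cite: Balaban1984PropagatorsII, (2.153)–(2.157) pp.249–250] -/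
structure FrameSubReduction.Printed (T : FrameSubReduction F N) (γ c₀ δ₀ r mC : ℝ) : Prop where
  symm : T.Δ.IsSymm
  decay : ∀ p q : F.Idx T.Ω N, |T.Δ p q| ≤ c₀ * Real.exp (-(δ₀ * F.ρ (p.1 : F.S) (q.1 : F.S)))
  lower : ∀ w : T.Fk → ℝ,
    γ * ∑ u, (T.C *ᵥ w) u ^ 2 ≤ ∑ u, (T.C *ᵥ w) u * (T.Δ *ᵥ (T.C *ᵥ w)) u
  iso : ∀ w : T.Fk → ℝ, ∑ k, w k ^ 2 ≤ ∑ u, (T.C *ᵥ w) u ^ 2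
  range : ∀ p k, T.C p k ≠ 0 → F.ρ (p.1 : F.S) ((k : F.Idx T.Ω N).1 : F.S) ≤ r
  col : ∀ k, ∑ p, |T.C p k| ≤ mC
  row : ∀ p, ∑ k, |T.C p k| ≤ mC

/-- KERNEL-CHECKED: padding an operator M on a sub-family Fk ⊆ Ω × Fin N that satisfies (5.6)_ρ on L²(Fk)
(symmetric, M ≥ γ, |M(f,f′)| ≤ ce^{−δρ(f₋,f′₋)}) by γ·1 on the removed variables gives an operator on L²(Ω; ℝ^N)
satisfying (5.6)_ρ with (γ, c + γ, δ) — `B6BondElimination.hyp56_pad` over a frame. [cite: Balaban1983RegularityDecay, (5.6) p.594] -/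
theorem hyp56_pad_frame {Ω : Finset F.S} {Fk : Finset (F.Idx Ω N)} {M : Matrix Fk Fk ℝ} {γ c δ : ℝ}
    (hγ : 0 ≤ γ) (hc : 0 ≤ c) (hs : M.IsSymm)
    (hl : ∀ w : Fk → ℝ, γ * ∑ f, w f ^ 2 ≤ ∑ f, w f * (M *ᵥ w) f)
    (hd : ∀ f f' : Fk, |M f f'| ≤ c * Real.exp (-(δ *
      F.ρ ((f : F.Idx Ω N).1 : F.S) ((f' : F.Idx Ω N).1 : F.S)))) :
    B6FrameReduction.Hyp56 F Ω (pad Fk M γ) γ (c + γ) δ := by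
  letI : PseudoMetricSpace F.S := F.pms
  exact ⟨pad_isSymm hs γ, pad_lower le_rfl hl,
    pad_decay (fun p : F.Idx Ω N => (p.1 : F.S)) hc hγ hd⟩

/-- KERNEL-CHECKED — the p. 250 scheme for an ARBITRARY sub-family of kept variables over a CLASS of frames: an
engine on 𝒞 (the theorem of [3] for the frames of 𝒞, constants before the instance) yields ONE c and ONE δ such
that every sub-family reduction over every (F, Ω) ∈ 𝒞 with printed-shape inputs (γ, c₀, δ₀, r, m) has
|C(C*ΔC)⁻¹C*(b,b′)| ≤ c·e^{−δρ(b₋,b′₋)}.  Chain (as `B6BondElimination.subReductions_uniform`): sandwich lemmas of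
`…B6FromB4` in `F.pms` → `hyp56_pad_frame` → engine → `pad_inv` → sandwich back; c = c₁e^{2δ₁r}m², δ = δ₁.
[cite: Balaban1984PropagatorsII, p.250] -/
theorem frameSubReductions_uniform {𝒞 : (F : Frame) → Finset F.S → Prop} (hE : Engine N 𝒞)
    {γ c₀ δ₀ r mC : ℝ} (hγ : 0 < γ) (hc : 0 < c₀) (hδ : 0 < δ₀) (hm : 0 < mC) :
    ∃ c δ : ℝ, 0 < c ∧ 0 < δ ∧ ∀ (F : Frame) (T : FrameSubReduction F N), 𝒞 F T.Ω → T.Printed γ c₀ δ₀ r mC →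
      ∀ p q : F.Idx T.Ω N, |T.cov p q| ≤ c * Real.exp (-(δ * F.ρ (p.1 : F.S) (q.1 : F.S))) := by
  have hc'0 : 0 < c₀ * Real.exp (2 * δ₀ * r) * mC * mC := by positivity
  obtain ⟨c₁, δ₁, hc₁, hδ₁, H⟩ := hE γ (c₀ * Real.exp (2 * δ₀ * r) * mC * mC + γ) δ₀ hγ (by positivity) hδ
  refine ⟨c₁ * Real.exp (2 * δ₁ * r) * mC * mC, δ₁, by positivity, hδ₁, fun F T hT hP p q => ?_⟩
  letI : PseudoMetricSpace F.S := F.pms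
  unfold FrameSubReduction.cov
  have hMs : (T.Cᵀ * T.Δ * T.C).IsSymm := B6FromB4.sandwich_isSymm T.C hP.symm
  have hMl : ∀ w : T.Fk → ℝ, γ * ∑ k, w k ^ 2 ≤ ∑ k, w k * ((T.Cᵀ * T.Δ * T.C) *ᵥ w) k :=
    B6FromB4.sandwich_lowerBound T.C T.Δ hγ.le hP.lower hP.iso
  have hMd : ∀ k k' : T.Fk, |(T.Cᵀ * T.Δ * T.C) k k'| ≤ c₀ * Real.exp (2 * δ₀ * r) * mC * mC *
      Real.exp (-(δ₀ * dist ((k : F.Idx T.Ω N).1 : F.S) ((k' : F.Idx T.Ω N).1 : F.S))) :=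
    B6FromB4.sandwich_decay (fun u : F.Idx T.Ω N => (u.1 : F.S))
      (fun k : T.Fk => ((k : F.Idx T.Ω N).1 : F.S)) T.Cᵀ T.Δ T.C hc.le hδ.le
      (fun i u h => by
        rw [dist_comm]
        exact hP.range u i (by simpa using h))
      (fun i => by simpa using hP.col i) hP.range hP.col hP.decay
  have h56 := hyp56_pad_frame hγ.le hc'0.le hMs hMl hMd
  have hInv := H F T.Ω hT _ h56
  have hdet : IsUnit (T.Cᵀ * T.Δ * T.C).det := isUnit_det_of_lower hγ hMl
  have hMinv : ∀ k k' : T.Fk, |(T.Cᵀ * T.Δ * T.C)⁻¹ k k'| ≤ c₁ *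
      Real.exp (-(δ₁ * dist ((k : F.Idx T.Ω N).1 : F.S) ((k' : F.Idx T.Ω N).1 : F.S))) := by
    intro k k'
    have := hInv k k'
    rwa [pad_inv _ hdet hγ.ne', pad_coe] at this
  exact B6FromB4.sandwich_decay (fun k : T.Fk => ((k : F.Idx T.Ω N).1 : F.S))
    (fun u : F.Idx T.Ω N => (u.1 : F.S)) T.C (T.Cᵀ * T.Δ * T.C)⁻¹ T.Cᵀ hc₁.le hδ₁.le
    hP.range hP.row
    (fun v k h => by
      rw [dist_comm]
      exact hP.range k v (by simpa using h))
    (fun k => by simpa using hP.row k) hMinv p q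

end FrameSub

/-! ## §2  The P-periodic frame on ℤ^d, separated regions, and its engine (proved) -/

section Periodic

variable {d : ℕ}

/-- The residue map ℤ^d → T_P = ∏_μ ℤ/P_μℤ, z ↦ (z_μ mod P_μ)_μ (all P_μ ≥ 1). [folklore] -/
def res (P : Fin d → ℕ) (hP : ∀ i, 1 ≤ P i) (z : Fin d → ℤ) : TSite d P :=
  fun i => ⟨(z i % (P i : ℤ)).toNat, by
    have h0 : (0 : ℤ) < (P i : ℤ) := by exact_mod_cast hP i
    have h1 : 0 ≤ z i % (P i : ℤ) := Int.emod_nonneg _ h0.ne'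
    have h2 : z i % (P i : ℤ) < (P i : ℤ) := Int.emod_lt_of_pos _ h0
    omega⟩

/-- The value of a residue coordinate, as an integer. [folklore] -/
theorem res_val (P : Fin d → ℕ) (hP : ∀ i, 1 ≤ P i) (z : Fin d → ℤ) (i : Fin d) :
    ((res P hP z i).val : ℤ) = z i % (P i : ℤ) := by
  have h0 : (0 : ℤ) < (P i : ℤ) := by exact_mod_cast hP i
  simp [res, Int.toNat_of_nonneg (Int.emod_nonneg _ h0.ne')]

/-- **The P-periodic sup-distance on ℤ^d**: ρ_P(z, z′) = max_μ dist(z_μ − z′_μ, P_μℤ) = the torus distance of the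
residues (B12 (1.9): distances *"in the sense of a periodic distance on the torus"*). [folklore] -/
def pdist (P : Fin d → ℕ) (hP : ∀ i, 1 ≤ P i) (z z' : Fin d → ℤ) : ℝ :=
  tdist P (res P hP z) (res P hP z')

/-- The coordinate circular distances of the residues are those of the integers themselves (periodicity).
[folklore] -/
theorem circAbs_res (P : Fin d → ℕ) (hP : ∀ i, 1 ≤ P i) (z z' : Fin d → ℤ) (i : Fin d) :
    B4TorusKernel.MultiPeriod.circAbs (P i) (((res P hP z i).val : ℤ) - ((res P hP z' i).val : ℤ)) =
      B4TorusKernel.MultiPeriod.circAbs (P i) (z i - z' i) := by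
  rw [res_val, res_val]
  have h : z i % (P i : ℤ) - z' i % (P i : ℤ) = (z i - z' i) + (P i : ℤ) * (z' i / (P i : ℤ) - z i / (P i : ℤ)) := by
    have h1 := Int.emod_def (z i) (P i : ℤ)
    have h2 := Int.emod_def (z' i) (P i : ℤ)
    linear_combination h1 - h2
  rw [h, B4TorusKernel.MultiPeriod.circAbs_add_mul]

/-- The torus distance is at most r (r ≥ 0) as soon as every coordinate circular distance is. [folklore] -/
theorem tdist_le_of_forall {P : Fin d → ℕ} (hP : ∀ i, 1 ≤ P i) (x y : TSite d P) {r : ℝ} (hr : 0 ≤ r)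
    (h : ∀ i, (B4TorusKernel.MultiPeriod.circAbs (P i) (((x i).val : ℤ) - ((y i).val : ℤ)) : ℝ) ≤ r) :
    tdist P x y ≤ r := by
  unfold tdist
  have hsup : Finset.univ.sup (B4Sect5Torus.ccoord P x y) ≤ ⌊r⌋₊ := by
    refine Finset.sup_le fun i _ => (Nat.le_floor_iff hr).2 ?_
    have h1 : ((B4Sect5Torus.ccoord P x y i : ℕ) : ℝ) =
        ((B4TorusKernel.MultiPeriod.circAbs (P i) (((x i).val : ℤ) - ((y i).val : ℤ)) : ℤ) : ℝ) := by
      rw [← B4Sect5Torus.ccoord_cast hP x y i]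
      norm_cast
    rw [h1]
    exact h i
  calc ((Finset.univ.sup (B4Sect5Torus.ccoord P x y) : ℕ) : ℝ) ≤ ((⌊r⌋₊ : ℕ) : ℝ) := by exact_mod_cast hsup
    _ ≤ r := Nat.floor_le hr

/-- ρ_P ≤ the sup-distance of ℤ^d: dist(z_μ − z′_μ, P_μℤ) ≤ |z_μ − z′_μ|. [folklore] -/
theorem pdist_le_dist (P : Fin d → ℕ) (hP : ∀ i, 1 ≤ P i) (z z' : Fin d → ℤ) :
    pdist P hP z z' ≤ dist z z' := by
  unfold pdist
  refine tdist_le_of_forall hP _ _ dist_nonneg fun i => ?_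
  rw [circAbs_res]
  calc (B4TorusKernel.MultiPeriod.circAbs (P i) (z i - z' i) : ℝ) ≤ ((|z i - z' i| : ℤ) : ℝ) := by
        exact_mod_cast B4TorusKernel.MultiPeriod.circAbs_le_abs (hP i) _
    _ = dist (z i) (z' i) := by rw [Int.dist_eq]; push_cast; rfl
    _ ≤ dist z z' := dist_le_pi_dist z z' i

variable (d)

/-- **The P-periodic frame** on ℤ^d: sites = integer representatives, ρ = ρ_P (a pseudo-metric: ρ_P(z, z′) = 0 iff
z ≡ z′ mod P).  Its ρ_P-separated finite regions are the regions of the torus T_P written in coordinates.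
(Reducible, so that `(zdPer d P hP).S` and `.Idx Ω N` are `Fin d → ℤ` and `B4.Idx Ω N` for the elaborator: the data of
`…B6BondElimination` is read over this frame without transport maps.) [cite: Balaban1984PropagatorsII, (2.152) p.249] -/
abbrev zdPer (P : Fin d → ℕ) (hP : ∀ i, 1 ≤ P i) : Frame where
  S := Fin d → ℤ
  ρ := pdist P hP
  ρ_self := fun _ => B4Sect5Torus.tdist_self P _
  ρ_comm := fun _ _ => B4Sect5Torus.tdist_symm hP _ _
  ρ_triangle := fun _ _ _ => B4Sect5Torus.tdist_triangle hP _ _ _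

/-- The pseudo-metric of the periodic frame is ρ_P (definitionally). [folklore] -/
theorem zdPer_ρ (P : Fin d → ℕ) (hP : ∀ i, 1 ≤ P i) (z z' : Fin d → ℤ) :
    (zdPer d P hP).ρ z z' = pdist P hP z z' := rfl

variable {d}

/-- A region is SEPARATED for a frame when ρ vanishes on it only on the diagonal (for `zdPer`: no two of its points
are congruent mod P, i.e. it injects into the torus). [folklore] -/
def Separated (F : Frame) (Ω : Finset F.S) : Prop :=
  ∀ z ∈ Ω, ∀ z' ∈ Ω, F.ρ z z' = 0 → z = z'

variable (d)

/-- The PERIODIC CLASS: all periodic frames (every period vector P), every separated finite region. [folklore] -/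
def perClass : (F : Frame) → Finset F.S → Prop :=
  fun F Ω => (∃ (P : Fin d → ℕ) (hP : ∀ i, 1 ≤ P i), F = zdPer d P hP) ∧ Separated F Ω

variable {d} {N : ℕ}

/-- On a separated region the residue map is injective. [folklore] -/
theorem res_injOn {P : Fin d → ℕ} {hP : ∀ i, 1 ≤ P i} {Ω : Finset (Fin d → ℤ)}
    (hsep : Separated (zdPer d P hP) Ω) : Set.InjOn (res P hP) (Ω : Set (Fin d → ℤ)) := by
  intro z hz z' hz' h
  refine hsep z (by exact_mod_cast hz) z' (by exact_mod_cast hz') ?_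
  show tdist P (res P hP z) (res P hP z') = 0
  rw [h, B4Sect5Torus.tdist_self]

/-- KERNEL-CHECKED — the lattice-sum PROFILE of the periodic frame on separated regions: Σ_{b′ ∈ Ω×Fin N}
e^{−aρ_P(b₋,b′₋)} ≤ N·K_d(a), uniformly in P and Ω (inject Ω into the torus and use `B4Sect5Torus.torusSum_le`).
[folklore] -/
theorem perSum_le {P : Fin d → ℕ} {hP : ∀ i, 1 ≤ P i} {Ω : Finset (Fin d → ℤ)}
    (hsep : Separated (zdPer d P hP) Ω) {a : ℝ} (ha : 0 < a) (p : (zdPer d P hP).Idx Ω N) :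
    ∑ q : (zdPer d P hP).Idx Ω N, Real.exp (-(a * (zdPer d P hP).ρ p.1.1 q.1.1)) ≤
      (N : ℝ) * B4Sect5Proof.latticeConst d a := by
  classical
  set x : TSite d P := res P hP p.1.1 with hx
  have h1 : ∑ q : (zdPer d P hP).Idx Ω N, Real.exp (-(a * (zdPer d P hP).ρ p.1.1 q.1.1)) =
      (N : ℝ) * ∑ z ∈ Ω, Real.exp (-(a * tdist P x (res P hP z))) := by
    simp only [pdist, ← hx]
    rw [Fintype.sum_prod_type]
    simp only [Finset.sum_const, Finset.card_univ, Fintype.card_fin, nsmul_eq_mul]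
    rw [← Finset.mul_sum, Finset.sum_coe_sort Ω (fun z => Real.exp (-(a * tdist P x (res P hP z))))]
  have h2 : ∑ z ∈ Ω, Real.exp (-(a * tdist P x (res P hP z))) =
      ∑ y ∈ Ω.image (res P hP), Real.exp (-(a * tdist P x y)) := by
    rw [Finset.sum_image]
    intro z hz z' hz' h
    exact res_injOn hsep hz hz' h
  have h3 : ∑ y ∈ Ω.image (res P hP), Real.exp (-(a * tdist P x y)) ≤
      ∑ y : TSite d P, Real.exp (-(a * tdist P x y)) :=
    Finset.sum_le_sum_of_subset_of_nonneg (Finset.subset_univ _) fun _ _ _ => (Real.exp_pos _).le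
  rw [h1, h2]
  exact mul_le_mul_of_nonneg_left (h3.trans (B4Sect5Torus.torusSum_le d hP ha x)) (Nat.cast_nonneg N)

variable (d N) in
/-- KERNEL-CHECKED — **THE ENGINE OF THE PERIODIC CLASS HOLDS**: for all positive (γ₀, c₀, δ₀) there are positive
(c₁, δ₁) such that for EVERY period vector P, EVERY separated region Ω₀ ⊂ ℤ^d (= region of the torus T_P) and every
A on L²(Ω₀; ℝ^N) with (5.6) in ρ_P, |A⁻¹(b,b′)| ≤ c₁e^{−δ₁ρ_P(b₋,b′₋)} — the theorem of [3] on tori in representative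
coordinates, from the profile `perSum_le` and `B6FrameReduction.engine_of_profileBound`. [cite: Balaban1983RegularityDecay, Sect. 5 Theorem p.594 + p.597] -/
theorem engine_per : Engine N (perClass d) :=
  B6FrameReduction.engine_of_profileBound (K := fun a => (N : ℝ) * B4Sect5Proof.latticeConst d a)
    (B4Sect5Torus.profile_nonneg d N)
    (by
      rintro F Ω ⟨⟨P, hP, rfl⟩, hsep⟩ a ha p
      exact perSum_le hsep ha p)

/-- The BOX ∏_μ [0, P_μ) ⊂ ℤ^d — a fundamental domain: it represents the WHOLE torus T_P ((2.152) *"on the whole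
lattice T^{(k)}"*). [folklore] -/
def box (P : Fin d → ℕ) : Finset (Fin d → ℤ) :=
  Fintype.piFinset fun i => Finset.Ico (0 : ℤ) (P i : ℤ)

/-- Membership in the box. [folklore] -/
theorem mem_box {P : Fin d → ℕ} {z : Fin d → ℤ} : z ∈ box P ↔ ∀ i, 0 ≤ z i ∧ z i < (P i : ℤ) := by
  simp [box, Fintype.mem_piFinset]

/-- A point of the torus at distance 0 from another is equal to it (`tdist` is a genuine metric on T_P). [folklore] -/
theorem eq_of_tdist_eq_zero {P : Fin d → ℕ} (hP : ∀ i, 1 ≤ P i) {x y : TSite d P} (h : tdist P x y = 0) :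
    x = y := by
  funext i
  have h1 := B4Sect5Torus.circAbs_le_tdist hP x y i
  rw [h] at h1
  have h2 := B4TorusKernel.MultiPeriod.circAbs_nonneg (hP i) (((x i).val : ℤ) - ((y i).val : ℤ))
  have h3 : B4TorusKernel.MultiPeriod.circAbs (P i) (((x i).val : ℤ) - ((y i).val : ℤ)) = 0 :=
    le_antisymm (by exact_mod_cast h1) h2
  -- circAbs = min (r % P, P − r % P) = 0 with 0 ≤ r % P < P forces r % P = 0
  unfold B4TorusKernel.MultiPeriod.circAbs at h3
  have hPi : (0 : ℤ) < (P i : ℤ) := by exact_mod_cast hP i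
  have hlt : (((x i).val : ℤ) - ((y i).val : ℤ)) % (P i : ℤ) < (P i : ℤ) := Int.emod_lt_of_pos _ hPi
  have hnn : 0 ≤ (((x i).val : ℤ) - ((y i).val : ℤ)) % (P i : ℤ) := Int.emod_nonneg _ hPi.ne'
  have hmod : (((x i).val : ℤ) - ((y i).val : ℤ)) % (P i : ℤ) = 0 := by
    rcases min_choice ((((x i).val : ℤ) - ((y i).val : ℤ)) % (P i : ℤ))
      ((P i : ℤ) - (((x i).val : ℤ) - ((y i).val : ℤ)) % (P i : ℤ)) with hm | hm <;> rw [hm] at h3 <;> omega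
  have hx : ((x i).val : ℤ) < (P i : ℤ) := by exact_mod_cast (x i).isLt
  have hy : ((y i).val : ℤ) < (P i : ℤ) := by exact_mod_cast (y i).isLt
  have hdvd : (P i : ℤ) ∣ (((x i).val : ℤ) - ((y i).val : ℤ)) := Int.dvd_of_emod_eq_zero hmod
  have heq : ((x i).val : ℤ) = ((y i).val : ℤ) := by
    rcases hdvd with ⟨k, hk⟩
    have hk0 : k = 0 := by
      by_contra hne
      rcases lt_or_gt_of_ne hne with hlt' | hgt'
      · nlinarith
      · nlinarith
    rw [hk0, mul_zero, sub_eq_zero] at hk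
    exact hk
  exact Fin.ext (by exact_mod_cast heq)

/-- KERNEL-CHECKED: the box is separated for the periodic frame — its points are pairwise incongruent mod P; so the
whole torus is an admissible region of `perClass`. [folklore] -/
theorem box_separated (P : Fin d → ℕ) (hP : ∀ i, 1 ≤ P i) : Separated (zdPer d P hP) (box P) := by
  intro z hz z' hz' h
  have hres : res P hP z = res P hP z' := eq_of_tdist_eq_zero hP h
  funext i
  have hi := congrArg (fun x : TSite d P => ((x i).val : ℤ)) hres
  simp only [res_val] at hi
  obtain ⟨hz0, hz1⟩ := (mem_box.1 hz) i
  obtain ⟨hz0', hz1'⟩ := (mem_box.1 hz') i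
  rwa [Int.emod_eq_of_lt hz0 hz1, Int.emod_eq_of_lt hz0' hz1'] at hi

/-- The box, hence the whole torus, is in the periodic class. [folklore] -/
theorem box_mem_perClass (P : Fin d → ℕ) (hP : ∀ i, 1 ≤ P i) : perClass d (zdPer d P hP) (box P) :=
  ⟨⟨P, hP, rfl⟩, box_separated P hP⟩

end Periodic

/-! ## §3  The explicit C of p. 250 on the torus: `B6BondElimination.bondReduction` read over the periodic frame -/

section Torus250

open B6BondElimination (SubReduction bondReduction Admissible LowerOnConstrained elimB_iso elimB_range elimB_col
  elimB_row avgQ_elimB_mulVec elimB_mulVec_tree)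

variable {d N : ℕ}

/-- A `B6BondElimination.SubReduction` (data typed over ℤ^d) READ over the periodic frame (same sites, kept variables,
Δ, C; only the distance changes). [folklore] -/
def ofPer (P : Fin d → ℕ) (hP : ∀ i, 1 ≤ P i) (T : SubReduction d N) : FrameSubReduction (zdPer d P hP) N :=
  ⟨T.Ω, T.F, T.Δ, T.C⟩

/-- Its covariance is the same matrix (2.156). [folklore] -/
theorem ofPer_cov (P : Fin d → ℕ) (hP : ∀ i, 1 ≤ P i) (T : SubReduction d N) : (ofPer P hP T).cov = T.cov := rfl

/-- The printed-shape inputs of a sub-family reduction IN THE PERIODIC DISTANCE ρ_P: as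
`B6BondElimination.SubReduction.Printed` with |b₋ − b′₋| ↦ ρ_P(b₋, b′₋) in the decay of Δ and in the range of C.
[cite: Balaban1984PropagatorsII, (2.153)–(2.157) pp.249–250] -/
def PrintedPer (P : Fin d → ℕ) (hP : ∀ i, 1 ≤ P i) (T : SubReduction d N) (γ c₀ δ₀ r mC : ℝ) : Prop :=
  (ofPer P hP T).Printed γ c₀ δ₀ r mC

variable (d N) in
/-- KERNEL-CHECKED — sub-family reductions ON THE TORI, [3] discharged: ONE (c, δ) such that for every period vector
P, every ρ_P-separated region and every sub-family reduction with printed-shape inputs in ρ_P,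
|C(C*ΔC)⁻¹C*(b,b′)| ≤ c·e^{−δρ_P(b₋,b′₋)} (`frameSubReductions_uniform` with the proved `engine_per`).
[cite: Balaban1984PropagatorsII, p.250] -/
theorem subReductions_per {γ c₀ δ₀ r mC : ℝ} (hγ : 0 < γ) (hc : 0 < c₀) (hδ : 0 < δ₀) (hm : 0 < mC) :
    ∃ c δ : ℝ, 0 < c ∧ 0 < δ ∧ ∀ (P : Fin d → ℕ) (hP : ∀ i, 1 ≤ P i) (T : SubReduction d N),
      Separated (zdPer d P hP) T.Ω → PrintedPer P hP T γ c₀ δ₀ r mC →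
      ∀ p q : B4.Idx T.Ω N, |T.cov p q| ≤ c * Real.exp (-(δ * pdist P hP (p.1 : Fin d → ℤ) (q.1 : Fin d → ℤ))) := by
  obtain ⟨c, δ, hc0, hδ0, H⟩ := frameSubReductions_uniform (N := N) (engine_per d N) hγ hc hδ hm
  exact ⟨c, δ, hc0, hδ0, fun P hP T hsep hT p q => H (zdPer d P hP) (ofPer P hP T) ⟨⟨P, hP, rfl⟩, hsep⟩ hT p q⟩

variable {L : ℕ} {Ω : Finset (Fin d → ℤ)} {K : Finset ((Fin d → ℤ) × Fin d)} {Y : Finset (Fin d → ℤ)}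

/-- KERNEL-CHECKED: admissible constraint data, Δ symmetric with entry decay (c₀, δ₀) IN THE PERIODIC DISTANCE and
the lower bound (2.153) with constant γ on {QB = 0, B(Γ_{y,x}) = 0} give the printed-shape inputs in ρ_P with range
L − 1 and ℓ¹ sums ≤ L^d + 1 for the explicit C = `B6BondElimination.elimB` — `bondReduction_printed` verbatim except
that the range bound |b₋ − f₋| ≤ L − 1 of `elimB_range` (distance of ℤ^d) is weakened to ρ_P ≤ |·| (`pdist_le_dist`).
[cite: Balaban1984PropagatorsII, (2.153)–(2.157) pp.249–250] -/
theorem bondReduction_printedPer {P : Fin d → ℕ} (hP : ∀ i, 1 ≤ P i) (hL : 0 < L) (hK : Admissible L Ω K)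
    {Δ : Matrix (B4.Idx Ω d) (B4.Idx Ω d) ℝ} {γ c₀ δ₀ : ℝ} (hs : Δ.IsSymm)
    (hd : ∀ p q : B4.Idx Ω d, |Δ p q| ≤ c₀ * Real.exp (-(δ₀ * pdist P hP (p.1 : Fin d → ℤ) (q.1 : Fin d → ℤ))))
    (hl : LowerOnConstrained L K Y Δ γ) :
    PrintedPer P hP (bondReduction L Ω K Y Δ) γ c₀ δ₀ ((L : ℝ) - 1) ((L : ℝ) ^ d + 1) where
  symm := hs
  decay := hd
  lower w := hl _ (fun c hc => avgQ_elimB_mulVec hL hK w hc) (fun p hp => elimB_mulVec_tree w hp)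
  iso w := elimB_iso w
  range p k h := (pdist_le_dist P hP _ _).trans (elimB_range hL p k h)
  col k := (elimB_col hL (fun c hc => (hK c hc).1) k).trans (by
    have h1 : (1 : ℝ) ≤ (L : ℝ) ^ d := one_le_pow₀ (by exact_mod_cast hL)
    linarith)
  row p := (elimB_row hL p).trans (by linarith)

variable (d) in
/-- KERNEL-CHECKED — **the sentence of p. 250 ON THE TORUS T^{(k)}, with [3] DISCHARGED**: *"C is a short-ranged
operator, so C*Δ_kC has the same exponential decay as Δ_k. Now we may apply the theory developed in Sect. 5 of [3] on
unit lattice operators. It gives us an exponential decay, and all the other properties, for the operator (C*Δ_kC)⁻¹,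
hence for C^{(k)}_Λ also."*  There are ONE c > 0 and ONE δ > 0 — chosen after (d, L, γ, c₀, δ₀) and BEFORE the torus
(period vector P), the region, the constraint data and the operator — such that for EVERY P, EVERY ρ_P-separated
region Ω₀ ⊂ ℤ^d of representatives (the box ∏[0,P_μ) = the whole torus T^{(k)} of (2.152) included, `box_separated`;
*"or on a subset Λ ⊂ T^{(k)}"*), EVERY admissible (K, Y) (constraint bonds c on the L-lattice with pivots in Ω₀ —
for the box with L ∣ P_μ: the blocks of the torus — and tree data), and EVERY symmetric Δ = Δ_k on the bond variables
Ω₀ × Fin d with |Δ(b,b′)| ≤ c₀e^{−δ₀ρ_P(b₋,b′₋)} (decay in the TORUS distance) and (2.153) with constant γ on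
{QB = 0, B(Γ_{y,x}) = 0}: the covariance (2.156) C^{(k)}_Λ = C(C*Δ_kC)⁻¹C* with the EXPLICIT C = `elimB` of p. 250
satisfies |C^{(k)}_Λ(b,b′)| ≤ c·e^{−δρ_P(b₋,b′₋)}.  Chain: `bondReduction_printedPer` → `subReductions_per`
(engine of the periodic class, proved). [cite: Balaban1984PropagatorsII, (2.152)–(2.157) pp.249–250] -/
theorem bond250_torus (hL : 0 < L) {γ c₀ δ₀ : ℝ} (hγ : 0 < γ) (hc : 0 < c₀) (hδ : 0 < δ₀) :
    ∃ c δ : ℝ, 0 < c ∧ 0 < δ ∧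
      ∀ (P : Fin d → ℕ) (hP : ∀ i, 1 ≤ P i) (Ω : Finset (Fin d → ℤ)), Separated (zdPer d P hP) Ω →
        ∀ (K : Finset ((Fin d → ℤ) × Fin d)) (Y : Finset (Fin d → ℤ)), Admissible L Ω K →
        ∀ Δ : Matrix (B4.Idx Ω d) (B4.Idx Ω d) ℝ, Δ.IsSymm →
        (∀ p q : B4.Idx Ω d, |Δ p q| ≤
          c₀ * Real.exp (-(δ₀ * pdist P hP (p.1 : Fin d → ℤ) (q.1 : Fin d → ℤ)))) →
        LowerOnConstrained L K Y Δ γ →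
        ∀ p q : B4.Idx Ω d, |(bondReduction L Ω K Y Δ).cov p q| ≤
          c * Real.exp (-(δ * pdist P hP (p.1 : Fin d → ℤ) (q.1 : Fin d → ℤ))) := by
  have hm : (0 : ℝ) < (L : ℝ) ^ d + 1 := by positivity
  obtain ⟨c, δ, hc', hδ', H⟩ := subReductions_per d d (r := (L : ℝ) - 1) hγ hc hδ hm
  exact ⟨c, δ, hc', hδ', fun P hP Ω hsep K Y hK Δ hs hd hl p q =>
    H P hP (bondReduction L Ω K Y Δ) hsep (bondReduction_printedPer hP hL hK hs hd hl) p q⟩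

end Torus250

end

end Literature.MathematicalPhysics.QuantumFieldTheory.Balaban1983to89.B6BondEliminationTorus
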